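import Summits.ResolutionOfSingularities.ResolutionOfSingularities.Theorems.PAlterationAssemblyReduction
import Summits.ResolutionOfSingularities.ResolutionOfSingularities.Theorems.PAlterationAssemblyFrobenius
import Summits.ResolutionOfSingularities.ResolutionOfSingularities.Theorems.PAlterationAssemblyRadicialSections
import Literature.AlgebraicGeometry.Resolution.SurfaceResolutionReduction
import Literature.AlgebraicGeometry.Resolution.AlterationsNormalizationReduction
import Literature.AlgebraicGeometry.Resolution.QuasiProjectiveResolution
import Mathlib.AlgebraicGeometry.Morphisms.Proper
import HarnessLib

/-!
# `PAlteration.Assembly` (stmt-ResolutionOfSingularities-0553): the thesis resolves varieties over PERFECT fields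

Route `ResolutionOfSingularities/pAlteration`, item `Assembly` (stmt-0553); helper file
(`--supports`). **Theorem A** (`hasResolution_of_pialt_picover_perfectField`): fix a prime `p`
and assume the two conjuncts of the thesis at `p` —
(PIAlt) every integral separated finite-type scheme over a field of characteristic `p` has a
proper surjective `g : X' → X` with `X'` integral regular and `g` finite, universally injective
over a dense open; (PICover) every integral scheme finite, universally injective and surjective
over a regular integral separated finite-type scheme over a field of characteristic `p` has a
resolution. Then every integral separated scheme of finite type over a PERFECT field `K` of
characteristic `p` has a resolution of singularities.

Proof. Normalise (`Scheme.HasResolution.of_normalization`). Take `g : X' → X` from (PIAlt) and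
an affine open `W` inside the good open. The finite radicial `g|_W` onto the normal `W` yields
(`exists_frobeniusFactor_app`) an exponent `N` such that `Frob^N` of `Γ(g⁻¹W)` factors through
`Γ(W)`. Let `F = F_X^N` be the `p^N`-power endomorphism of `X`; it is FINITE because `K` is
perfect (`isFinite_powEndo`), universally injective and surjective. The reduced Frobenius
pull-back `Z = (X ×_{F,X,g} X')_red` is integral and finite radicial surjective over the regular
`X'`, so (PICover) resolves `Z`; and `Z → X` is proper and birational: over `W` it has the
section `w ↦ (w, σ-point)` and is injective, hence an isomorphism (`isIso_of_comp_eq_id_of_injective`).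
-/

-- single-problem summit: the doubled namespace component `ResolutionOfSingularities` is forced
set_option linter.dupNamespace false

noncomputable section

open CategoryTheory CategoryTheory.Limits AlgebraicGeometry TopologicalSpace Topology

open Literature.AlgebraicGeometry.Resolution Literature.AlgebraicGeometry.Motives
open Scheme.IdealSheafData

namespace Summit.ResolutionOfSingularities.ResolutionOfSingularities.Theorems

universe u

/-! ## Generic preliminaries -/

section Prelim

variable {X Y : Scheme.{u}}

/-- A property local at the target passes from `f ∣_ U` to `f ∣_ W` for `W ≤ U`. [folklore] -/
theorem restrict_of_le {P : MorphismProperty Scheme.{u}} [IsZariskiLocalAtTarget P]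
    (f : X ⟶ Y) {U W : Y.Opens} (hWU : W ≤ U) (h : P (f ∣_ U)) : P (f ∣_ W) := by
  have e : U.ι ''ᵁ (U.ι ⁻¹ᵁ W) = W := by
    rw [Scheme.Hom.image_preimage_eq_opensRange_inf, Scheme.Opens.opensRange_ι, inf_eq_right.mpr hWU]
  have h' : P (f ∣_ U ∣_ (U.ι ⁻¹ᵁ W)) := IsZariskiLocalAtTarget.restrict h _
  exact (P.arrow_mk_iso_iff (morphismRestrictRestrict f U (U.ι ⁻¹ᵁ W) ≪≫ morphismRestrictEq f e)).mp h'

/-- The power endomorphism is universally injective: it is injective on points and induces the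
(purely inseparable) power map on residue fields. [folklore] -/
theorem universallyInjective_powEndo (X : Scheme.{u}) (p : ℕ) [Fact p.Prime] (N : ℕ)
    (hadd : ∀ (U : X.Opens) (a b : Γ(X, U)), (a + b) ^ p ^ N = a ^ p ^ N + b ^ p ^ N)
    (hp : (p : Γ(X, ⊤)) = 0) :
    UniversallyInjective (powEndo X (p ^ N) (pow_ne_zero N (Fact.out : p.Prime).ne_zero) hadd) := by
  set F := powEndo X (p ^ N) (pow_ne_zero N (Fact.out : p.Prime).ne_zero) hadd with hF
  suffices key : ∀ x, (F.residueFieldMap x).hom.IsPurelyInseparable by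
    have h2 : Function.Injective F.base ∧ ∀ x, (F.residueFieldMap x).hom.IsPurelyInseparable :=
      ⟨fun x y h => h, key⟩
    exact ((tfae_universallyInjective F).out 0 2).mpr h2
  intro x
  letI := (F.residueFieldMap x).hom.toAlgebra
  have hpx : (p : X.residueField x) = 0 := by
    rw [← map_natCast (X.Γevaluation x).hom p, hp, map_zero]
  haveI : CharP (X.residueField (F.base x)) p := (CharP.charP_iff_prime_eq_zero Fact.out).mpr hpx
  show IsPurelyInseparable _ _
  rw [isPurelyInseparable_iff_pow_mem _ p]
  intro y
  refine ⟨N, ?_⟩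
  obtain ⟨t, rfl⟩ := Ideal.Quotient.mk_surjective y
  obtain ⟨W, hxW, s, rfl⟩ := X.presheaf.exists_germ_eq t
  refine RingHom.mem_range.mpr ⟨X.evaluation W x hxW s, ?_⟩
  change F.residueFieldMap x (X.evaluation W (F.base x) hxW s) = _
  rw [Scheme.evaluation_naturality_apply]
  change X.evaluation W x hxW (s ^ p ^ N) = _
  rw [map_pow]
  rfl

/-- Integrally closed stalks pass to open subschemes. [folklore] -/
theorem isIntegrallyClosed_stalk_opens (U : X.Opens)
    (h : ∀ x : X, IsIntegrallyClosed (X.presheaf.stalk x)) (x : U) :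
    IsIntegrallyClosed ((U : Scheme.{u}).presheaf.stalk x) := by
  haveI := h x.1
  exact IsIntegrallyClosed.of_equiv (U.stalkIso x).commRingCatIsoToRingEquiv.symm

end Prelim

/-! ## Theorem A -/

/-- **Theorem A.** For a prime `p`, the conjunction of (PIAlt_p) — purely inseparable regular
alterations of integral varieties over fields of characteristic `p` — and (PICover_p) —
resolution of finite radicial covers of regular varieties over fields of characteristic `p` —
implies resolution of singularities for every integral separated scheme of finite type over a
PERFECT field of characteristic `p` (Frobenius pull-back of the alteration; see the module
docstring). [folklore] -/
theorem hasResolution_of_pialt_picover_perfectField (p : ℕ) (hp : p.Prime)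
    (hPI : ∀ (k : Type) [Field k] [CharP k p] (X : Scheme.{0}) (f : X ⟶ Spec (.of k)),
      IsSeparated f → LocallyOfFiniteType f → QuasiCompact f → IsIntegral X →
      ∃ (X' : Scheme.{0}) (g : X' ⟶ X), IsProper g ∧ IsIntegral X' ∧ Scheme.IsRegular X' ∧
        Function.Surjective g.base ∧ ∃ U : X.Opens, Dense (U : Set X) ∧ IsFinite (g ∣_ U) ∧
        UniversallyInjective (g ∣_ U))
    (hPC : ∀ (k : Type) [Field k] [CharP k p] (Y X : Scheme.{0}) (f : Y ⟶ Spec (.of k))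
      (g : X ⟶ Y), IsSeparated f → LocallyOfFiniteType f → QuasiCompact f → IsIntegral Y →
      Scheme.IsRegular Y → IsIntegral X → IsFinite g → UniversallyInjective g →
      Function.Surjective g.base → Scheme.HasResolution X)
    (K : Type) [Field K] [CharP K p] [PerfectField K] (X : Scheme.{0}) (f : X ⟶ Spec (.of K))
    [IsSeparated f] [LocallyOfFiniteType f] [QuasiCompact f] [IsIntegral X] :
    Scheme.HasResolution X := by
  haveI : Fact p.Prime := ⟨hp⟩
  -- Step 0: we may assume `X` normal
  wlog hnorm : ∀ x : X, IsIntegrallyClosed (X.presheaf.stalk x) generalizing X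
  · haveI hfinν := isFinite_normalizationι X NoetherFiniteIntegralClosure_holds f
    refine Scheme.HasResolution.of_normalization X f ?_
    exact this (normalization X) (normalizationι X ≫ f) (isIntegrallyClosed_stalk_normalization X)
  -- Step 1: the purely inseparable regular alteration
  obtain ⟨X', g, hgP, hX'int, hX'reg, hgsurj, U, hUd, hgfin, hgui⟩ :=
    hPI K X f ‹_› ‹_› ‹_› ‹_›
  haveI := hgP
  haveI := hX'int
  haveI : Surjective g := ⟨hgsurj⟩
  -- Step 2: a non-empty affine open `W ⊆ U`
  obtain ⟨x₀⟩ := (inferInstance : Nonempty X)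
  obtain ⟨u, hu⟩ := hUd.nonempty
  obtain ⟨W, hW, huW, hWU⟩ : ∃ W : X.Opens, W ∈ X.affineOpens ∧ u ∈ W ∧ W ≤ U :=
    Opens.isBasis_iff_nbhd.mp X.isBasis_affineOpens hu
  haveI hgWfin : IsFinite (g ∣_ W) := restrict_of_le g hWU hgfin
  haveI hgWui : UniversallyInjective (g ∣_ W) := restrict_of_le g hWU hgui
  haveI : Nonempty W := ⟨⟨u, huW⟩⟩
  haveI : IsIntegral (W : Scheme.{0}) := isIntegral_of_isOpenImmersion W.ι
  obtain ⟨x', hx'⟩ := hgsurj u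
  haveI : Nonempty (g ⁻¹ᵁ W) := ⟨⟨x', show g.base x' ∈ W by rw [hx']; exact huW⟩⟩
  haveI : IsIntegral (g ⁻¹ᵁ W : Scheme.{0}) := isIntegral_of_isOpenImmersion (g ⁻¹ᵁ W).ι
  haveI : Surjective (g ∣_ W) := IsZariskiLocalAtTarget.restrict ‹Surjective g› W
  haveI : IsAffine W := hW
  -- characteristic
  have hpX : (p : Γ(X, ⊤)) = 0 := natCast_appTop_eq_zero p f
  have hpW : (p : Γ((W : Scheme.{0}), ⊤)) = 0 := by
    rw [← map_natCast W.ι.appTop.hom p, hpX, map_zero]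
  -- Step 3: the Frobenius factor over `W`
  haveI : Nonempty ((g ∣_ W) ⁻¹ᵁ (⊤ : (W : Scheme.{0}).Opens)) :=
    ⟨⟨Classical.arbitrary _, trivial⟩⟩
  haveI : Nonempty (⊤ : (W : Scheme.{0}).Opens) := ⟨⟨Classical.arbitrary _, trivial⟩⟩
  obtain ⟨N, σ, hσ1, hσ2⟩ := exists_frobeniusFactor_app (g ∣_ W)
    (isIntegrallyClosed_stalk_opens W hnorm) p hpW ⊤ (isAffineOpen_top _)
  -- Step 4: the finite Frobenius power `F`
  have hadd := add_pow_sections p hpX N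
  set F := powEndo X (p ^ N) (pow_ne_zero N hp.ne_zero) hadd with hFdef
  haveI : IsFinite F := isFinite_powEndo p f N hadd
  haveI : UniversallyInjective F := universallyInjective_powEndo X p N hadd hpX
  haveI : Surjective F := ⟨fun x => ⟨x, rfl⟩⟩
  -- Step 5: the reduced Frobenius pull-back `Z` and its resolution from (PICover)
  set Z := (vanishingIdeal (⊤ : Closeds ↑(pullback F g))).subscheme with hZdef
  set ι := (vanishingIdeal (⊤ : Closeds ↑(pullback F g))).subschemeι with hιdef
  haveI : IsIntegral Z := isIntegral_reduced_pullback F g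
  have hZres : Scheme.HasResolution Z :=
    hPC K X' Z (g ≫ f) (ι ≫ pullback.snd F g) inferInstance inferInstance inferInstance hX'int
      hX'reg inferInstance (isFinite_reduced_pullback_snd F g)
      (universallyInjective_reduced_pullback_snd F g) (surjective_reduced_pullback_snd F g).1
  -- Step 6: `π : Z → X` is proper and birational
  set π := ι ≫ pullback.fst F g with hπdef
  haveI : IsProper π := inferInstance
  refine Scheme.HasResolution.of_isBirational π ⟨W, W.2.dense ⟨u, huW⟩, ?_, ?_⟩ hZres
  · -- `π⁻¹ W` is a non-empty open of the irreducible `Z`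
    refine (π ⁻¹ᵁ W).2.dense ?_
    obtain ⟨z, hz⟩ := (inferInstance : Surjective π).1 u
    exact ⟨z, show π.base z ∈ W by rw [hz]; exact huW⟩
  -- `π` is injective over `W`
  have hmem : ∀ c : ↥(π ⁻¹ᵁ W), g.base ((pullback.snd F g).base (ι.base c.1)) ∈ W := by
    intro c
    rw [← Scheme.Hom.comp_apply, ← pullback.condition, Scheme.Hom.comp_apply]
    exact c.2
  have hinj : Function.Injective (π ∣_ W).base := by
    intro a b hab
    have h1 : π.base a.1 = π.base b.1 := by
      have := congrArg Subtype.val hab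
      rwa [morphismRestrict_base_coe, morphismRestrict_base_coe] at this
    have h3 : (pullback.snd F g).base (ι.base a.1) = (pullback.snd F g).base (ι.base b.1) := by
      have key : (g ∣_ W).base ⟨_, hmem a⟩ = (g ∣_ W).base ⟨_, hmem b⟩ := by
        apply Subtype.ext
        rw [morphismRestrict_base_coe, morphismRestrict_base_coe]
        change (pullback.snd F g ≫ g).base (ι.base a.1) = (pullback.snd F g ≫ g).base (ι.base b.1)
        rw [← pullback.condition]
        exact h1
      exact congrArg Subtype.val ((g ∣_ W).injective key)
    exact Subtype.ext (ι.isClosedEmbedding.injective ((pullback.snd F g).injective h3))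
  -- the section over `W`: first `b₀ : W → g⁻¹ W`, `Spec` of the Frobenius factor `σ`
  haveI : IsAffine (g ⁻¹ᵁ W : Scheme.{0}) := isAffine_of_isAffineHom (g ∣_ W)
  obtain ⟨σ', -, hσ2'⟩ : ∃ σ' : Γ((g ⁻¹ᵁ W : Scheme.{0}), ⊤) →+* Γ((W : Scheme.{0}), ⊤),
      (∀ c, (g ∣_ W).appTop (σ' c) = c ^ p ^ N) ∧ ∀ a, σ' ((g ∣_ W).appTop a) = a ^ p ^ N :=
    ⟨σ, hσ1, hσ2⟩
  have haddW := add_pow_sections p hpW N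
  have hpS : (p : Γ(Spec Γ((W : Scheme.{0}), ⊤), ⊤)) = 0 :=
    natCast_appTop_eq_zero p ((W : Scheme.{0}).isoSpec.inv ≫ W.ι ≫ f)
  have haddS := add_pow_sections p hpS N
  let τ : Γ((g ⁻¹ᵁ W : Scheme.{0}), ⊤) ⟶ Γ((W : Scheme.{0}), ⊤) := CommRingCat.ofHom σ'
  have e1 : (g ∣_ W).appTop ≫ τ = CommRingCat.ofHom (powRingHom Γ((W : Scheme.{0}), ⊤) (p ^ N)
      (pow_ne_zero N hp.ne_zero) (haddW ⊤)) := by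
    ext a
    simp only [τ, CommRingCat.hom_comp, CommRingCat.hom_ofHom, RingHom.comp_apply, powRingHom_apply]
    exact hσ2' a
  let b₀ : (W : Scheme.{0}) ⟶ (g ⁻¹ᵁ W : Scheme.{0}) :=
    (W : Scheme.{0}).isoSpec.hom ≫ Spec.map τ ≫ (g ⁻¹ᵁ W : Scheme.{0}).isoSpec.inv
  have hb₀ : b₀ ≫ (g ∣_ W) = powEndo (W : Scheme.{0}) (p ^ N) (pow_ne_zero N hp.ne_zero) haddW := by
    have h1 : (g ⁻¹ᵁ W : Scheme.{0}).isoSpec.inv ≫ (g ∣_ W) =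
        Spec.map (g ∣_ W).appTop ≫ (W : Scheme.{0}).isoSpec.inv :=
      (Scheme.isoSpec_inv_naturality _).symm
    have h3 : Spec.map (CommRingCat.ofHom (powRingHom Γ((W : Scheme.{0}), ⊤) (p ^ N)
        (pow_ne_zero N hp.ne_zero) (haddW ⊤))) =
        powEndo (Spec Γ((W : Scheme.{0}), ⊤)) (p ^ N) (pow_ne_zero N hp.ne_zero) haddS :=
      (powEndo_Spec (p ^ N) (pow_ne_zero N hp.ne_zero) (Γ((W : Scheme.{0}), ⊤)) (haddW ⊤) haddS).symm
    have h2 : Spec.map τ ≫ Spec.map (g ∣_ W).appTop =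
        powEndo (Spec Γ((W : Scheme.{0}), ⊤)) (p ^ N) (pow_ne_zero N hp.ne_zero) haddS := by
      rw [← Spec.map_comp, e1, h3]
    have h4 : (W : Scheme.{0}).isoSpec.hom ≫
        powEndo (Spec Γ((W : Scheme.{0}), ⊤)) (p ^ N) (pow_ne_zero N hp.ne_zero) haddS =
        powEndo (W : Scheme.{0}) (p ^ N) (pow_ne_zero N hp.ne_zero) haddW ≫ (W : Scheme.{0}).isoSpec.hom :=
      (powEndo_comp (p ^ N) (pow_ne_zero N hp.ne_zero) haddW _ haddS).symm
    simp only [b₀, Category.assoc]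
    rw [h1, ← Category.assoc (Spec.map τ), h2, ← Category.assoc, h4, Category.assoc, Iso.hom_inv_id,
      Category.comp_id]
  -- the point of the pull-back over `W`
  have hw : W.ι ≫ F = (b₀ ≫ (g ⁻¹ᵁ W).ι) ≫ g := by
    rw [Category.assoc, ← morphismRestrict_ι, ← Category.assoc, hb₀, hFdef,
      powEndo_comp (p ^ N) (pow_ne_zero N hp.ne_zero) haddW W.ι hadd]
  obtain ⟨s₁, hs₁⟩ := exists_lift_reduced (pullback.lift W.ι (b₀ ≫ (g ⁻¹ᵁ W).ι) hw)
  have hs₁π : s₁ ≫ π = W.ι := by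
    rw [hπdef, ← Category.assoc, hιdef, hs₁, pullback.lift_fst]
  have hrange : Set.range s₁.base ⊆ Set.range (π ⁻¹ᵁ W).ι.base := by
    rintro _ ⟨w, rfl⟩
    rw [Scheme.Opens.range_ι]
    show π.base (s₁.base w) ∈ W
    rw [← Scheme.Hom.comp_apply, hs₁π]
    exact w.2
  have hs : IsOpenImmersion.lift (π ⁻¹ᵁ W).ι s₁ hrange ≫ (π ∣_ W) = 𝟙 _ := by
    rw [← cancel_mono W.ι, Category.assoc, morphismRestrict_ι, ← Category.assoc,
      IsOpenImmersion.lift_fac, hs₁π, Category.id_comp]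
  exact isIso_of_comp_eq_id_of_injective (π ∣_ W) hinj _ hs

end Summit.ResolutionOfSingularities.ResolutionOfSingularities.Theorems

end
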